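import Summits.QuantumFields.GaugeBoot.SOMasterLoopPointwise
import HarnessLib

/-!
# Assembly of the `SO(N)` master loop equation: the integrated identity in Chatterjee's terms, real form (gauge-boot, ADDENDUM 27 part M5d)

HONEST FRAMING (cell `pub-gaugeboot`, page 1 of every file): the venture produces certified bounds
on lattice expectations at stated coupling, gauge group, dimension and torus size; NOT a mass gap,
NOT a continuum limit, NOT a string tension; NOT Yang–Mills-summit-bearing (barriers
`FixedCouplingUltralocality`, `PerturbativeInvisibility`).  An exact finite-`N` identity for the free-boundary
`SO(N)` lattice gauge measure; nothing about the large-`N` limit is claimed here.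

## Content

Eleventh file of the lane's programme on the tree's NAMED FACT `Chatterjee2019LargeN.UnsymmetrizedMasterLoopEquation`
(Chatterjee, CMP 366 (2019), Theorem 8.1): the identities of parts M5b (integrated, per location and direction) and
M5c (pointwise contractions) are summed over all locations `x` of `l` and all directions `X_ij` and rewritten as an
identity between REAL integrals of products of Wilson loop variables:

  `(N−1)·m·∫ W_l Π W = ∫ (twisting) Π W + ∫ (splitting) Π W + ∫ (merger) + β' ∫ (deformation) Π W`

(★ `masterLoop_real_identity`, with the four real integrands `twistFun`, `splitFun`, `mergeFun`, `deformFun`), together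
with the geometric input ★ `plaquettes_mem_of_vertices` (Chatterjee's hypothesis «all vertices at distance `≤ 1` from the
loops lie in `Λ`» puts every plaquette through the marked link inside `Λ`).  Part M5e matches the four integrals with
`twistTermAt`, `splitTermAt`, `mergeTermAt`, `deformTermAt` of `MasterLoopEquation`.

Everything is `[folklore]`.
-/

noncomputable section

open NormedSpace MeasureTheory
open scoped Matrix.Norms.Frobenius Matrix
open Literature.Probability.LatticeModels (Site)
open Literature.MathematicalPhysics.QuantumLattice (LGConfig ZdEdge ZdPlaquette plaquettesTouching plaquetteEdges
  mem_plaquettesTouching_iff)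
open Literature.MathematicalPhysics.QuantumFieldTheory (Chatterjee2019LargeN.Word zdWilsonMeasure plaquettesIn latticeNorm)
open Literature.MathematicalPhysics.QuantumFieldTheory.Chatterjee2019LargeN
  (SO soRep DEdge LoopSeq wilsonLoopVar wilsonProd plaquetteWord plaquettesAt)
open Literature.MathematicalPhysics.QuantumFieldTheory.Chatterjee2019LargeN.Word
  (locs occ samePairs invPairs posSplit₁ posSplit₂ negSplit₁ negSplit₂ negTwist posTwist posMerge negMerge posDeform
   negDeform)

namespace Summit.QuantumFields.GaugeBoot

namespace SOMasterLoop

variable {d N : ℕ}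

/-! ## §1 Chatterjee's vertex hypothesis puts the plaquettes through the marked link inside `Λ` -/

section Vertices

/-- `|e_k| = 1`. [folklore] -/
theorem latticeNorm_single_one (k : Fin d) : latticeNorm (Pi.single k (1 : ℤ) : Site d) = 1 := by
  have h : (fun i => ((Pi.single k (1 : ℤ) : Site d) i : ℝ)) = Pi.single k (1 : ℝ) := by
    funext i
    by_cases hi : i = k
    · subst hi; simp
    · simp [hi]
  rw [latticeNorm, h, PiLp.toLp_single, PiLp.norm_single, norm_one]

/-- `|−v| = |v|`. [folklore] -/
theorem latticeNorm_neg (v : Site d) : latticeNorm (-v) = latticeNorm v := by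
  unfold latticeNorm
  have h : (WithLp.toLp 2 fun i => ((-v) i : ℝ) : EuclideanSpace ℝ (Fin d)) =
      -(WithLp.toLp 2 fun i => (v i : ℝ)) := by
    ext i; simp
  rw [h, norm_neg]

/-- `|0| = 0`. [folklore] -/
theorem latticeNorm_zero : latticeNorm (0 : Site d) = 0 := by
  unfold latticeNorm
  have h : (WithLp.toLp 2 fun i => ((0 : Site d) i : ℝ) : EuclideanSpace ℝ (Fin d)) = 0 := by ext i; simp
  rw [h, norm_zero]

/-- Membership in `plaquettesIn Λ`: the four corners lie in `Λ`. [folklore] -/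
theorem mem_plaquettesIn_iff {Λ : Finset (Site d)} {q : Site d} {i j : Fin d} :
    ((q, i, j) : Site d × Fin d × Fin d) ∈ plaquettesIn Λ ↔
      i < j ∧ q ∈ Λ ∧ q + Pi.single i 1 ∈ Λ ∧ q + Pi.single j 1 ∈ Λ ∧ q + Pi.single i 1 + Pi.single j 1 ∈ Λ := by
  simp only [plaquettesIn, Finset.mem_filter, Finset.mem_product, Finset.mem_univ, and_true]
  tauto

/-- ★ **The vertex hypothesis of Theorem 8.1 implies that every plaquette through the marked link lies in `Λ`.**
[folklore] -/
theorem plaquettes_mem_of_vertices {Λ : Finset (Site d)} {s : LoopSeq d} {l : Chatterjee2019LargeN.Word d} (hl : l ∈ s)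
    (hΛ : ∀ l' ∈ s, ∀ a ∈ l', ∀ v : Site d,
      latticeNorm (v - DEdge.src a) ≤ 1 ∨ latticeNorm (v - DEdge.tgt a) ≤ 1 → v ∈ Λ)
    (x : Fin l.length) :
    ∀ p ∈ plaquettesTouching ({(l.get x).1} : Finset (ZdEdge d)),
      ((p.1, p.2.1.1, p.2.1.2) : Site d × Fin d × Fin d) ∈ plaquettesIn Λ := by
  intro p hp
  set e := l.get x with he
  have ha : e ∈ l := List.get_mem l x
  -- the two endpoints of the undirected link `e.1 = (y, k)` are `y` and `y + e_k`
  have hend : ∀ v : Site d, latticeNorm (v - e.1.1) ≤ 1 ∨ latticeNorm (v - (e.1.1 + Pi.single e.1.2 1)) ≤ 1 → v ∈ Λ := by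
    intro v hv
    refine hΛ l hl e ha v ?_
    rcases e with ⟨⟨y, k⟩, b⟩
    cases b
    · simp only [DEdge.src, DEdge.tgt, Bool.false_eq_true, if_false] at hv ⊢
      exact hv.symm
    · simp only [DEdge.src, DEdge.tgt, if_true] at hv ⊢
      exact hv
  have h0 : ∀ v : Site d, latticeNorm (v - v) ≤ 1 := fun v => by rw [sub_self, latticeNorm_zero]; norm_num
  have h1 : ∀ (v : Site d) (k : Fin d), latticeNorm (v + Pi.single k 1 - v) ≤ 1 := fun v k => by
    rw [add_sub_cancel_left, latticeNorm_single_one]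
  have h1' : ∀ (v : Site d) (k : Fin d), latticeNorm (v - (v + Pi.single k 1)) ≤ 1 := fun v k => by
    rw [sub_add_eq_sub_sub, sub_self, zero_sub, latticeNorm_neg, latticeNorm_single_one]
  obtain ⟨q, ⟨⟨i, j⟩, hij⟩⟩ := p
  rw [mem_plaquettesIn_iff]
  refine ⟨hij, ?_⟩
  rw [mem_plaquettesTouching_iff] at hp
  obtain ⟨f, hf⟩ := hp
  rw [Finset.mem_inter, Finset.mem_singleton] at hf
  obtain ⟨hf, rfl⟩ := hf
  simp only [plaquetteEdges, Finset.mem_insert, Finset.mem_singleton] at hf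
  rcases hf with hf | hf | hf | hf <;> rw [hf] at hend
  · exact ⟨hend _ (Or.inl (h0 _)), hend _ (Or.inr (h0 _)), hend _ (Or.inl (h1 _ _)),
      hend _ (Or.inr (by rw [add_sub_cancel_left, latticeNorm_single_one]))⟩
  · refine ⟨hend _ (Or.inl (h1' _ _)), hend _ (Or.inl (h0 _)), hend _ (Or.inr ?_), hend _ (Or.inr (h0 _))⟩
    rw [show q + Pi.single j 1 - (q + Pi.single i 1 + Pi.single j 1) = -Pi.single i 1 by abel, latticeNorm_neg,
      latticeNorm_single_one]
  · refine ⟨hend _ (Or.inl (h1' _ _)), hend _ (Or.inr ?_), hend _ (Or.inl (h0 _)), hend _ (Or.inr ?_)⟩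
    · rw [show q + Pi.single i 1 - (q + Pi.single j 1 + Pi.single i 1) = -Pi.single j 1 by abel, latticeNorm_neg,
        latticeNorm_single_one]
    · rw [show q + Pi.single i 1 + Pi.single j 1 - (q + Pi.single j 1 + Pi.single i 1) = 0 by abel, latticeNorm_zero]
      norm_num
  · refine ⟨hend _ (Or.inl (h0 _)), hend _ (Or.inl (h1 _ _)), hend _ (Or.inr (h0 _)), hend _ (Or.inr ?_)⟩
    rw [show q + Pi.single i 1 + Pi.single j 1 - (q + Pi.single j 1) = Pi.single i 1 by abel, latticeNorm_single_one]

end Vertices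

/-! ## §2 The four real integrands -/

section Integrands

variable (N)
variable (l : Chatterjee2019LargeN.Word d) (rest : LoopSeq d) (e : DEdge d)

/-- Twisting integrand: `Σ_{same} W(∝⁻) − Σ_{inv} W(∝⁺)`. [folklore] -/
def twistFun (U : LGConfig d (SO N)) : ℝ :=
  ∑ xy ∈ samePairs l e, wilsonLoopVar N (negTwist l xy.1 xy.2) U -
    ∑ xy ∈ invPairs l e, wilsonLoopVar N (posTwist l xy.1 xy.2) U

/-- Splitting integrand: `Σ_{inv} W(×¹⁻)W(×²⁻) − Σ_{same} W(×¹⁺)W(×²⁺)`. [folklore] -/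
def splitFun (U : LGConfig d (SO N)) : ℝ :=
  ∑ xy ∈ invPairs l e, wilsonLoopVar N (negSplit₁ l xy.1 xy.2) U * wilsonLoopVar N (negSplit₂ l xy.1 xy.2) U -
    ∑ xy ∈ samePairs l e, wilsonLoopVar N (posSplit₁ l xy.1 xy.2) U * wilsonLoopVar N (posSplit₂ l xy.1 xy.2) U

/-- Merger integrand: `Σ_r Σ_{x ∈ C₁} Σ_{y ∈ C_r} (Π_{r' ≠ r} W_{l_{r'}}) (W(l ⊖ l_r) − W(l ⊕ l_r))`. [folklore] -/
def mergeFun (U : LGConfig d (SO N)) : ℝ :=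
  ∑ r : Fin rest.length, (∏ r' ∈ Finset.univ.erase r, wilsonLoopVar N (rest.get r') U) *
    ∑ x ∈ locs l e, ∑ y ∈ locs (rest.get r) e,
      (wilsonLoopVar N (negMerge l x (rest.get r) y) U - wilsonLoopVar N (posMerge l x (rest.get r) y) U)

/-- Deformation integrand: `Σ_{p ∈ 𝒫⁺(e)} Σ_{x ∈ C₁} (W(l ⊖ₓ p) − W(l ⊕ₓ p))`. [folklore] -/
def deformFun (U : LGConfig d (SO N)) : ℝ :=
  ∑ p ∈ plaquettesAt e, ∑ x ∈ locs l e, (wilsonLoopVar N (negDeform l x p) U - wilsonLoopVar N (posDeform l x p) U)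

variable {N}

/-- The pointwise LEFT side, summed, in real terms. [folklore] -/
theorem sum_lhs_eq (U : LGConfig d (SO N)) :
    ∑ x : Fin l.length, ∑ i : Fin N, ∑ j : Fin N,
      ((∑ y : Fin l.length, (ins2Prod e.1 (soDir i j) l x y U).trace) * prodW rest U +
        (insProd e.1 (soDir i j) l x U).trace * prodW' e.1 (soDir i j) rest U) =
      ((wilsonProd N rest U * (-(2 * ((N : ℝ) - 1)) * (occ l e : ℝ) * wilsonLoopVar N l U +
          2 * (twistFun N l e U + splitFun N l e U)) + 2 * mergeFun N l rest e U : ℝ) : ℂ) := by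
  have hx : ∀ x : Fin l.length, ∑ i : Fin N, ∑ j : Fin N,
      (∑ y : Fin l.length, (ins2Prod e.1 (soDir i j) l x y U).trace) * prodW rest U =
      prodW rest U * ∑ y : Fin l.length, pairSum U l e (x, y) := by
    intro x
    set P := prodW rest U with hP
    set A : Fin N → Fin N → Fin l.length → ℂ := fun i j y => (ins2Prod e.1 (soDir i j) l x y U).trace with hA
    calc ∑ i : Fin N, ∑ j : Fin N, (∑ y : Fin l.length, A i j y) * P
        = ∑ i : Fin N, ∑ j : Fin N, ∑ y : Fin l.length, P * A i j y := by
          refine Finset.sum_congr rfl fun i _ => Finset.sum_congr rfl fun j _ => ?_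
          rw [Finset.sum_mul]
          exact Finset.sum_congr rfl fun y _ => mul_comm _ _
      _ = ∑ i : Fin N, ∑ y : Fin l.length, ∑ j : Fin N, P * A i j y := Finset.sum_congr rfl fun i _ => Finset.sum_comm
      _ = ∑ y : Fin l.length, ∑ i : Fin N, ∑ j : Fin N, P * A i j y := Finset.sum_comm
      _ = P * ∑ y : Fin l.length, pairSum U l e (x, y) := by simp only [pairSum, Finset.mul_sum, hA]
  have hsplit : ∑ x : Fin l.length, ∑ i : Fin N, ∑ j : Fin N,
      ((∑ y : Fin l.length, (ins2Prod e.1 (soDir i j) l x y U).trace) * prodW rest U +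
        (insProd e.1 (soDir i j) l x U).trace * prodW' e.1 (soDir i j) rest U) =
      prodW rest U * ∑ x : Fin l.length, ∑ y : Fin l.length, pairSum U l e (x, y) +
        ∑ x : Fin l.length, ∑ i : Fin N, ∑ j : Fin N,
          (insProd e.1 (soDir i j) l x U).trace * prodW' e.1 (soDir i j) rest U := by
    simp only [Finset.sum_add_distrib, hx]
    rw [Finset.mul_sum]
  rw [hsplit, sum_ins2_eq, sum_merge_eq, prodW_eq_ofReal_wilsonProd]
  simp only [twistFun, splitFun, mergeFun, trace_holC]
  push_cast
  simp only [Finset.sum_sub_distrib, mul_sub, Finset.mul_sum]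
  ring

/-- The pointwise RIGHT side, summed, in real terms. [folklore] -/
theorem sum_rhs_eq (U : LGConfig d (SO N)) :
    ∑ x : Fin l.length, ∑ i : Fin N, ∑ j : Fin N,
      (insProd e.1 (soDir i j) l x U).trace * prodW rest U *
        (actionDeriv' e.1 (soDir i j : Matrix (Fin N) (Fin N) ℂ) U : ℂ) =
      ((wilsonProd N rest U * (-(2 * deformFun N l e U)) : ℝ) : ℂ) := by
  have h : ∑ x : Fin l.length, ∑ i : Fin N, ∑ j : Fin N,
      (insProd e.1 (soDir i j) l x U).trace * prodW rest U *
        (actionDeriv' e.1 (soDir i j : Matrix (Fin N) (Fin N) ℂ) U : ℂ) =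
      prodW rest U * ∑ x : Fin l.length, ∑ i : Fin N, ∑ j : Fin N,
        (insProd e.1 (soDir i j) l x U).trace * (actionDeriv' e.1 (soDir i j : Matrix (Fin N) (Fin N) ℂ) U : ℂ) := by
    simp only [Finset.mul_sum]
    refine Finset.sum_congr rfl fun x _ => Finset.sum_congr rfl fun i _ => Finset.sum_congr rfl fun j _ => ?_
    ring
  rw [h, sum_deform_eq, prodW_eq_ofReal_wilsonProd]
  simp only [deformFun, trace_holC]
  push_cast
  ring

end Integrands

/-! ## §3 Integration -/

section Integration

variable (β' : ℝ) (Λ : Finset (Site d)) (l : Chatterjee2019LargeN.Word d) (rest : LoopSeq d) (e : DEdge d)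

/-- Real continuous functions on the compact configuration space are integrable. [folklore] -/
theorem integrable_real_of_continuous {f : LGConfig d (SO N) → ℝ} (hf : Continuous f) :
    Integrable f (zdWilsonMeasure (soRep N) β' Λ) := by
  haveI := isProbabilityMeasure_soWilson (d := d) (N := N) β' Λ
  have h := TiltedRP.integrable_of_continuous_zd (soLatticeRep N) (zdWilsonMeasure (soRep N) β' Λ)
    (Complex.continuous_ofReal.comp hf)
  simpa using h.re

/-- `W_w` is continuous in the configuration. [folklore] -/
theorem continuous_wilsonLoopVar (w : Chatterjee2019LargeN.Word d) :
    Continuous fun U : LGConfig d (SO N) => wilsonLoopVar N w U := by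
  have h : (fun U : LGConfig d (SO N) => wilsonLoopVar N w U) = fun U => ((holC U w).trace).re := by
    funext U; rw [trace_holC, Complex.ofReal_re]
  rw [h]
  exact Complex.continuous_re.comp (continuous_prod_letterMat w).matrix_trace

/-- `Π W` is continuous. [folklore] -/
theorem continuous_wilsonProd (s : LoopSeq d) : Continuous fun U : LGConfig d (SO N) => wilsonProd N s U := by
  have h : (fun U : LGConfig d (SO N) => wilsonProd N s U) = fun U => ∏ r : Fin s.length, wilsonLoopVar N (s.get r) U := by
    funext U; rw [wilsonProd, prod_map_eq_prod_fin]
  rw [h]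
  exact continuous_finsetProd _ fun r _ => continuous_wilsonLoopVar _

/-- The four integrands are continuous. [folklore] -/
theorem continuous_integrands :
    Continuous (twistFun N l e : LGConfig d (SO N) → ℝ) ∧ Continuous (splitFun N l e : LGConfig d (SO N) → ℝ) ∧
      Continuous (mergeFun N l rest e : LGConfig d (SO N) → ℝ) ∧ Continuous (deformFun N l e : LGConfig d (SO N) → ℝ) := by
  refine ⟨?_, ?_, ?_, ?_⟩
  · unfold twistFun
    exact (continuous_finsetSum _ fun xy _ => continuous_wilsonLoopVar _).sub
      (continuous_finsetSum _ fun xy _ => continuous_wilsonLoopVar _)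
  · unfold splitFun
    exact (continuous_finsetSum _ fun xy _ => (continuous_wilsonLoopVar _).mul (continuous_wilsonLoopVar _)).sub
      (continuous_finsetSum _ fun xy _ => (continuous_wilsonLoopVar _).mul (continuous_wilsonLoopVar _))
  · unfold mergeFun
    exact continuous_finsetSum _ fun r _ => (continuous_finsetProd _ fun r' _ => continuous_wilsonLoopVar _).mul
      (continuous_finsetSum _ fun x _ => continuous_finsetSum _ fun y _ =>
        (continuous_wilsonLoopVar _).sub (continuous_wilsonLoopVar _))
  · unfold deformFun
    exact continuous_finsetSum _ fun p _ => continuous_finsetSum _ fun x _ =>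
      (continuous_wilsonLoopVar _).sub (continuous_wilsonLoopVar _)

/-- ★ **The master loop identity, real integrated form.**  For a link all of whose plaquettes lie in `Λ`:
`(N−1)·m·∫ W_l Π W = ∫ twist·Π W + ∫ split·Π W + ∫ merge + β'·∫ deform·Π W`. [folklore] -/
theorem masterLoop_real_identity
    (hl : ∀ p ∈ plaquettesTouching ({e.1} : Finset (ZdEdge d)),
      ((p.1, p.2.1.1, p.2.1.2) : Site d × Fin d × Fin d) ∈ plaquettesIn Λ) :
    ((N : ℝ) - 1) * (occ l e : ℝ) * ∫ U, wilsonLoopVar N l U * wilsonProd N rest U ∂(zdWilsonMeasure (soRep N) β' Λ) =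
      (∫ U, twistFun N l e U * wilsonProd N rest U ∂(zdWilsonMeasure (soRep N) β' Λ)) +
      (∫ U, splitFun N l e U * wilsonProd N rest U ∂(zdWilsonMeasure (soRep N) β' Λ)) +
      (∫ U, mergeFun N l rest e U ∂(zdWilsonMeasure (soRep N) β' Λ)) +
      β' * ∫ U, deformFun N l e U * wilsonProd N rest U ∂(zdWilsonMeasure (soRep N) β' Λ) := by
  set μ := zdWilsonMeasure (d := d) (soRep N) β' Λ with hμ
  haveI : IsProbabilityMeasure μ := isProbabilityMeasure_soWilson (d := d) (N := N) β' Λ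
  -- integrability of the complex summands
  have hIL : ∀ (x : Fin l.length) (i j : Fin N), Integrable (fun U : LGConfig d (SO N) =>
      (∑ y : Fin l.length, (ins2Prod e.1 (soDir i j) l x y U).trace) * prodW rest U +
        (insProd e.1 (soDir i j) l x U).trace * prodW' e.1 (soDir i j) rest U) μ := by
    intro x i j
    exact TiltedRP.integrable_of_continuous_zd (soLatticeRep N) μ
      (((continuous_finsetSum _ fun y _ => (continuous_ins2Prod e.1 _ l x y).matrix_trace).mul
        (continuous_prodW rest)).add ((continuous_insProd e.1 _ l x).matrix_trace.mul (continuous_prodW' e.1 _ rest)))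
  have hIR : ∀ (x : Fin l.length) (i j : Fin N), Integrable (fun U : LGConfig d (SO N) =>
      (insProd e.1 (soDir i j) l x U).trace * prodW rest U *
        (actionDeriv' e.1 (soDir i j : Matrix (Fin N) (Fin N) ℂ) U : ℂ)) μ := by
    intro x i j
    exact TiltedRP.integrable_of_continuous_zd (soLatticeRep N) μ
      (((continuous_insProd e.1 _ l x).matrix_trace.mul (continuous_prodW rest)).mul
        (Complex.continuous_ofReal.comp continuous_actionDeriv'))
  -- sum the per-(x,i,j) identities
  have hsum : ∫ U, ∑ x : Fin l.length, ∑ i : Fin N, ∑ j : Fin N,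
      ((∑ y : Fin l.length, (ins2Prod e.1 (soDir i j) l x y U).trace) * prodW rest U +
        (insProd e.1 (soDir i j) l x U).trace * prodW' e.1 (soDir i j) rest U) ∂μ =
      (β' : ℂ) * ∫ U, ∑ x : Fin l.length, ∑ i : Fin N, ∑ j : Fin N,
        (insProd e.1 (soDir i j) l x U).trace * prodW rest U *
          (actionDeriv' e.1 (soDir i j : Matrix (Fin N) (Fin N) ℂ) U : ℂ) ∂μ := by
    rw [integral_finsetSum _ (fun x _ => integrable_finsetSum _ fun i _ => integrable_finsetSum _ fun j _ => hIL x i j),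
      integral_finsetSum _ (fun x _ => integrable_finsetSum _ fun i _ => integrable_finsetSum _ fun j _ => hIR x i j),
      Finset.mul_sum]
    refine Finset.sum_congr rfl fun x _ => ?_
    rw [integral_finsetSum _ (fun i _ => integrable_finsetSum _ fun j _ => hIL x i j),
      integral_finsetSum _ (fun i _ => integrable_finsetSum _ fun j _ => hIR x i j), Finset.mul_sum]
    refine Finset.sum_congr rfl fun i _ => ?_
    rw [integral_finsetSum _ (fun j _ => hIL x i j), integral_finsetSum _ (fun j _ => hIR x i j), Finset.mul_sum]
    refine Finset.sum_congr rfl fun j _ => ?_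
    exact integral_pair_identity β' Λ e.1 hl l rest x i j
  simp only [sum_lhs_eq, sum_rhs_eq] at hsum
  rw [integral_complex_ofReal, integral_complex_ofReal, ← Complex.ofReal_mul] at hsum
  have hreal := Complex.ofReal_injective hsum
  -- integrability of the real pieces
  obtain ⟨cT, cS, cM, cD⟩ := continuous_integrands (N := N) l rest e
  have cW := continuous_wilsonLoopVar (N := N) (d := d) l
  have cP := continuous_wilsonProd (N := N) (d := d) rest
  set c : ℝ := -(2 * ((N : ℝ) - 1)) * (occ l e : ℝ) with hc
  have iW : Integrable (fun U => c * (wilsonLoopVar N l U * wilsonProd N rest U)) μ :=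
    integrable_real_of_continuous β' Λ (continuous_const.mul (cW.mul cP))
  have iT : Integrable (fun U => 2 * (twistFun N l e U * wilsonProd N rest U)) μ :=
    integrable_real_of_continuous β' Λ (continuous_const.mul (cT.mul cP))
  have iS : Integrable (fun U => 2 * (splitFun N l e U * wilsonProd N rest U)) μ :=
    integrable_real_of_continuous β' Λ (continuous_const.mul (cS.mul cP))
  have iM : Integrable (fun U => 2 * mergeFun N l rest e U) μ :=
    integrable_real_of_continuous β' Λ (continuous_const.mul cM)
  have e1 : ∫ U, (wilsonProd N rest U * (-(2 * ((N : ℝ) - 1)) * (occ l e : ℝ) * wilsonLoopVar N l U +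
      2 * (twistFun N l e U + splitFun N l e U)) + 2 * mergeFun N l rest e U) ∂μ =
      c * (∫ U, wilsonLoopVar N l U * wilsonProd N rest U ∂μ) +
        2 * (∫ U, twistFun N l e U * wilsonProd N rest U ∂μ) + 2 * (∫ U, splitFun N l e U * wilsonProd N rest U ∂μ) +
        2 * ∫ U, mergeFun N l rest e U ∂μ := by
    have hpt : (fun U => wilsonProd N rest U * (-(2 * ((N : ℝ) - 1)) * (occ l e : ℝ) * wilsonLoopVar N l U +
        2 * (twistFun N l e U + splitFun N l e U)) + 2 * mergeFun N l rest e U) =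
        fun U => c * (wilsonLoopVar N l U * wilsonProd N rest U) + 2 * (twistFun N l e U * wilsonProd N rest U) +
          2 * (splitFun N l e U * wilsonProd N rest U) + 2 * mergeFun N l rest e U := by
      funext U; rw [hc]; ring
    have i12 : Integrable (fun U => c * (wilsonLoopVar N l U * wilsonProd N rest U) +
        2 * (twistFun N l e U * wilsonProd N rest U)) μ := iW.add iT
    have i123 : Integrable (fun U => c * (wilsonLoopVar N l U * wilsonProd N rest U) +
        2 * (twistFun N l e U * wilsonProd N rest U) + 2 * (splitFun N l e U * wilsonProd N rest U)) μ := i12.add iS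
    rw [hpt, integral_add i123 iM, integral_add i12 iS, integral_add iW iT, integral_const_mul,
      integral_const_mul, integral_const_mul, integral_const_mul]
  have e2 : ∫ U, wilsonProd N rest U * (-(2 * deformFun N l e U)) ∂μ =
      (-2) * ∫ U, deformFun N l e U * wilsonProd N rest U ∂μ := by
    have hpt : (fun U => wilsonProd N rest U * (-(2 * deformFun N l e U))) =
        fun U => (-2) * (deformFun N l e U * wilsonProd N rest U) := by
      funext U; ring
    rw [hpt, integral_const_mul]
  rw [e1, e2, hc] at hreal
  have hN1 : ((N : ℝ) - 1) * (occ l e : ℝ) * ∫ U, wilsonLoopVar N l U * wilsonProd N rest U ∂μ =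
      (∫ U, twistFun N l e U * wilsonProd N rest U ∂μ) + (∫ U, splitFun N l e U * wilsonProd N rest U ∂μ) +
      (∫ U, mergeFun N l rest e U ∂μ) + β' * ∫ U, deformFun N l e U * wilsonProd N rest U ∂μ := by
    linarith
  exact hN1

end Integration

end SOMasterLoop

end Summit.QuantumFields.GaugeBoot
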